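/-
Copyright: statement-level skeleton of a published paper (lit-balaban cell, Phase-2 proof seat p39 gen 11). No proof claims
beyond what the kernel checks below.
-/
import Literature.MathematicalPhysics.QuantumFieldTheory.Balaban1983to89.B3WT226PeriodicKernel

/-!
# B3 — T. Bałaban, *(Higgs)₂,₃ quantum fields in a finite volume. III. Renormalization*, CMP **88** (1983) 411–445
[Balaban1983Higgs3], p. 431 [PDF 21]: *"They hold for free boundary conditions also by taking a limit of the identities with
periodic boundary conditions"* — THE PRINTED ROUTE to (2.26) at free boundary conditions, REPLAYED: the periodization
`C_N = Σ_{n∈ℤ^d}C(· + Nn)` of the infinite-volume propagator IS an even solution of the torus lattice equation (torus propagator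
= periodized free propagator), the torus identity (file 1/2 `B3WT226PeriodicKernel.bracketT_eq_zero`) holds for it, the torus
bracket EQUALS for large `N` the free bracket with `C` replaced by `C_N`, `C_N → C`, hence the free bracket is the LIMIT of the
periodic ones and vanishes (file 2/2)

statement-level skeleton of published theorems with citation tags; proofs where landed; nothing here is a claim about
the Yang–Mills mass gap

PDF held: `paper:balaban1983-higgs-2-3-quantum-fields-finite-volume` (journal page = PDF page + 410); p. 431 [PDF 21] read on the
×2 render `run/shared/lean/pub/pub-balaban/b2b-balaban-ref1/pages/1983-cmp88-higgs23-III/1983-cmp88-higgs23-III-p021-x2.png`.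

CITATION HEADER (lean-in-tree rule).  Part of the lit-balaban TYPED SKELETON (HOME `run/shared/lean/pub/lit-balaban/`), PHASE 2,
proof seat p39 (generation 11).  WHAT IS REPRODUCED: row **B3.Eq2.26-2.28** of `HOME/lit-balaban-r15/ROWS-B3.md` (fold owner
r15): the METHOD clause of the p. 431 sentence, for the identity (2.26).  Companions: `B3WT226FreeLattice` (gen 11: the free
bracket `bracket226`, proved `= 0` DIRECTLY there — this file gives the second, printed-route proof for finitely supported test
functions), `B3WT226PeriodicKernel` (gen 11: the torus bracket `bracketT` and its vanishing).

THE PRINTED TEXT (verbatim, p. 431 [PDF 21]).  *"Taking other functions F, or differentiating (2.24) to higher order in A, we can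
get all necessary Ward-Takahashi identities. They hold for free boundary conditions also by taking a limit of the identities with
periodic boundary conditions."*

WHAT IS TYPED / PROVED (`d` arbitrary; `ZSite d = ℤ^d` the free lattice, `TSite d N = (ℤ/Nℤ)^d` the torus, `proj N : ℤ^d → (ℤ/Nℤ)^d`
the reduction; spacing `η > 0`).
* §1 the reduction map `proj` (additive, `proj e_μ = e_μ`), its kernel (`proj a = proj b ↔ a − b ∈ Nℤ^d`), injectivity on sets
  of diameter `< N`, the section `lift`.
* §2 THE PERIODIZATION `perC N C z = Σ'_{n∈ℤ^d}C(z + Nn)` of a polynomially-weighted summable kernel: `N`-periodic, even if `C` is,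
  and — **`negLapZ_perC_add`** — a solution of the lattice equation with the PERIODIC delta: `(−Δ^η + M²)C_N(z) = η^{−d}·1[z ∈ Nℤ^d]`
  whenever `(−Δ^η + M²)C = δ^η`.
* §3 the torus kernel `CT N C = perC N C ∘ lift` on `(ℤ/Nℤ)^d`: even, and **`negLapT_CT_add`**: it solves the torus lattice equation
  `(−Δ^η_T + M²)CT = δ^η_T` of `B3WT226PeriodicKernel` — so the torus identity `bracketT_eq_zero` applies to it (**`bracketT_CT_eq_zero`**).
* §4 the periodized test function `lamT` of a finitely supported `λ` and its agreement with `λ` along `proj` for large `N`.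
* §5 **`bracketT_CT_eq_bracketFin`** — for `N` beyond an explicit threshold (the diameter of the support data), the torus bracket at
  the bond `(proj x, μ)` with kernel `CT N C` and test function `lamT` EQUALS the free bracket expression with kernel `C_N` summed
  over the (fixed, finite) support set; **`bracket226_eq_bracketFin`** — the free bracket of `B3WT226FreeLattice` is that finite
  expression with kernel `C`.
* §6 THE LIMIT: **`tendsto_perC`** (`C_N(z) → C(z)` as `N → ∞`, with the explicit tail bound `|C_N(z) − C(z)| ≤ S/(1 + N − |z|₁)`),
  **`tendsto_bracketFin`** (the finite-support bracket is continuous in the kernel along `C_N → C`), **`bracketFin_perC_eq_zero`**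
  (the torus identities force the `C_N`-bracket to vanish for every period `N` beyond the threshold), and the printed conclusion
  **`bracket226_eq_zero_of_periodic_limit`** (with the displayed form **`eq226_free_of_periodic_limit`**): for every even `C` on `ℤ^d` with `(−Δ^η + M²)C = δ^η` and `Σ(1 + |z|₁)^m|C(z)| < ∞`
  (`m ≥ 1`), every finitely supported `λ`, every bond: `bracket226 η C λ x μ = 0` — (2.26) at free boundary conditions *"by taking
  a limit of the identities with periodic boundary conditions"*; instance **`bracket226_CetaM_eq_zero_of_periodic_limit`** for the
  infinite-volume propagator `C^η_{M²}`.
HONEST SCOPE: kernel-level right member of (2.26) (as in the companions); finitely supported test functions `λ` (the direct proof of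
`B3WT226FreeLattice` covers polynomial growth); the torus is the abstract `(ℤ/Nℤ)^d`, ONE period `N` in all directions, with
the periodized propagator (the model's torus `T^{(j)}` of `B3WT226Traces` — `HiggsLattice.Site`, periods `2L^{K−j}ML′_μ` per
direction — is not re-identified with it here); constants explicit but not optimized.  Mathlib + the cited tree
files only; definitions with bodies and theorems, no named fact, no `sorry`; standard axioms.  Unit `lit-balaban-p39-g11` (Phase-2
proof seat p39, gen 11), HOME `run/shared/lean/pub/lit-balaban/`, 2026-08-22.
-/

open scoped BigOperators Topology
open Finset Filter

namespace Literature.MathematicalPhysics.QuantumFieldTheory.Balaban1983to89.B3WT226PeriodicLimit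

open B3Sect3VectorSelfEnergy B3CxiPropagator B3WT226FreeLattice B3WT226PeriodicKernel

noncomputable section

variable {d : ℕ}

/-! ## §1 The reduction `ℤ^d → (ℤ/Nℤ)^d` -/

/-- the reduction map `proj N : ℤ^d → (ℤ/Nℤ)^d` (componentwise residue). [cite: Balaban1983Higgs3, (2.26) p.431] -/
def proj (N : ℕ) (z : ZSite d) : TSite d N := fun i => ((z i : ℤ) : ZMod N)

/-- the section `lift : (ℤ/Nℤ)^d → ℤ^d` (componentwise least nonnegative representative). [cite: Balaban1983Higgs3, (2.26) p.431] -/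
def lift {N : ℕ} [NeZero N] (t : TSite d N) : ZSite d := fun i => ((t i).val : ℤ)

variable {N : ℕ}

/-- kernel: `proj` is additive. [cite: Balaban1983Higgs3, (2.26) p.431] -/
theorem proj_add (a b : ZSite d) : proj N (a + b) = proj N a + proj N b := by
  funext i; simp [proj]

/-- kernel: `proj` commutes with subtraction. [cite: Balaban1983Higgs3, (2.26) p.431] -/
theorem proj_sub (a b : ZSite d) : proj N (a - b) = proj N a - proj N b := by
  funext i; simp [proj]

/-- kernel: `proj (−a) = −proj a`. [cite: Balaban1983Higgs3, (2.26) p.431] -/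
theorem proj_neg (a : ZSite d) : proj N (-a) = -proj N a := by
  funext i; simp [proj]

/-- kernel: `proj 0 = 0`. [cite: Balaban1983Higgs3, (2.26) p.431] -/
theorem proj_zero : proj N (0 : ZSite d) = 0 := by
  funext i; simp [proj]

/-- kernel: `proj e_μ = e_μ`. [cite: Balaban1983Higgs3, (2.26) p.431] -/
theorem proj_unitVec (μ : Fin d) : proj N (unitVec μ : ZSite d) = unitVecT μ := by
  funext i
  by_cases h : i = μ
  · subst h; simp [proj, unitVec, unitVecT]
  · simp [proj, unitVec, unitVecT, h]

/-- kernel: a multiple of `N` reduces to `0`. [cite: Balaban1983Higgs3, (2.26) p.431] -/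
theorem proj_nsmul (n : ZSite d) : proj N ((N : ℤ) • n) = 0 := by
  funext i
  simp only [proj, Pi.smul_apply, smul_eq_mul, Int.cast_mul, Int.cast_natCast, ZMod.natCast_self, zero_mul,
    Pi.zero_apply]

/-- kernel: THE KERNEL OF `proj` — `proj a = proj b ↔ a = b + Nn` for some `n ∈ ℤ^d`. [cite: Balaban1983Higgs3, (2.26) p.431] -/
theorem proj_eq_iff (a b : ZSite d) : proj N a = proj N b ↔ ∃ n : ZSite d, a = b + (N : ℤ) • n := by
  constructor
  · intro h
    have hi : ∀ i, ((N : ℤ)) ∣ a i - b i := by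
      intro i
      have := congr_fun h i
      simp only [proj] at this
      exact (ZMod.intCast_eq_intCast_iff_dvd_sub (b i) (a i) N).mp this.symm
    choose k hk using hi
    refine ⟨k, funext fun i => ?_⟩
    simp only [Pi.add_apply, Pi.smul_apply, smul_eq_mul]
    linarith [hk i]
  · rintro ⟨n, rfl⟩
    rw [proj_add, proj_nsmul, add_zero]

/-- kernel: `proj z = 0 ↔ z ∈ Nℤ^d`. [cite: Balaban1983Higgs3, (2.26) p.431] -/
theorem proj_eq_zero_iff (z : ZSite d) : proj N z = 0 ↔ ∃ n : ZSite d, z + (N : ℤ) • n = 0 := by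
  rw [← proj_zero (N := N), proj_eq_iff]
  constructor
  · rintro ⟨n, hn⟩; exact ⟨-n, by rw [hn, smul_neg, zero_add, add_neg_cancel]⟩
  · rintro ⟨n, hn⟩; exact ⟨-n, by rw [smul_neg, zero_add]; exact eq_neg_of_add_eq_zero_left hn⟩

/-- kernel: `proj ∘ lift = id`. [cite: Balaban1983Higgs3, (2.26) p.431] -/
theorem proj_lift [NeZero N] (t : TSite d N) : proj N (lift t) = t := by
  funext i; simp [proj, lift]

/-- kernel: `lift (proj z) = z + Nn` for some `n`. [cite: Balaban1983Higgs3, (2.26) p.431] -/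
theorem lift_proj [NeZero N] (z : ZSite d) : ∃ n : ZSite d, lift (proj N z) = z + (N : ℤ) • n :=
  (proj_eq_iff _ _).mp (proj_lift _)

/-- kernel: `proj` is injective on any set of sites whose coordinates differ by less than `N`. [cite: Balaban1983Higgs3, (2.26) p.431] -/
theorem eq_of_proj_eq {a b : ZSite d} (hab : ∀ i, |a i - b i| < N) (h : proj N a = proj N b) : a = b := by
  obtain ⟨n, hn⟩ := (proj_eq_iff a b).mp h
  funext i
  have h1 : a i - b i = (N : ℤ) * n i := by rw [hn]; simp
  have h2 : (N : ℤ) ∣ a i - b i := ⟨n i, h1⟩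
  have h3 := Int.eq_zero_of_abs_lt_dvd h2 (by exact_mod_cast hab i)
  linarith

/-- kernel: coordinates differ by at most the sum of the `ℓ¹` sizes. [cite: Balaban1983Higgs3, (2.26) p.431] -/
theorem abs_sub_apply_le (a b : ZSite d) (i : Fin d) : |a i - b i| ≤ (l1 a : ℤ) + (l1 b : ℤ) := by
  have ha : |a i| ≤ (l1 a : ℤ) := by
    have := Finset.single_le_sum (f := fun ν => (a ν).natAbs) (fun _ _ => Nat.zero_le _) (Finset.mem_univ i)
    rw [Int.abs_eq_natAbs]; exact_mod_cast this
  have hb : |b i| ≤ (l1 b : ℤ) := by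
    have := Finset.single_le_sum (f := fun ν => (b ν).natAbs) (fun _ _ => Nat.zero_le _) (Finset.mem_univ i)
    rw [Int.abs_eq_natAbs]; exact_mod_cast this
  calc |a i - b i| ≤ |a i| + |b i| := abs_sub _ _
    _ ≤ (l1 a : ℤ) + (l1 b : ℤ) := add_le_add ha hb

/-- kernel: `proj` is injective on a finite set `T` as soon as `N > 2·max_{T}|·|₁`. [cite: Balaban1983Higgs3, (2.26) p.431] -/
theorem injOn_proj_of_lt (T : Finset (ZSite d)) (hN : 2 * T.sup (fun z => l1 z) < N) :
    Set.InjOn (proj N) (T : Set (ZSite d)) := by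
  intro a ha b hb h
  refine eq_of_proj_eq (fun i => ?_) h
  have h1 : l1 a ≤ T.sup (fun z => l1 z) := Finset.le_sup (f := fun z => l1 z) ha
  have h2 : l1 b ≤ T.sup (fun z => l1 z) := Finset.le_sup (f := fun z => l1 z) hb
  calc |a i - b i| ≤ (l1 a : ℤ) + (l1 b : ℤ) := abs_sub_apply_le a b i
    _ < N := by exact_mod_cast (by omega : l1 a + l1 b < N)

/-! ## §2 The periodization `C_N = Σ_n C(· + Nn)` of an infinite-lattice kernel -/

/-- **the periodization** `C_N(z) = Σ'_{n∈ℤ^d} C(z + Nn)` of a kernel on `ℤ^d` (the torus propagator of period `N` built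
from the infinite-volume one). [cite: Balaban1983Higgs3, (2.26) p.431] -/
def perC (N : ℕ) (C : ZSite d → ℝ) (z : ZSite d) : ℝ := ∑' n : ZSite d, C (z + (N : ℤ) • n)

section Periodization

variable {m : ℕ} {C : ZSite d → ℝ}

/-- kernel: `n ↦ z + Nn` is injective for `N ≥ 1`. [cite: Balaban1983Higgs3, (2.26) p.431] -/
theorem injective_translate (hN : 1 ≤ N) (z : ZSite d) : Function.Injective fun n : ZSite d => z + (N : ℤ) • n := by
  intro a b h
  have h' : (N : ℤ) • a = (N : ℤ) • b := add_left_cancel h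
  funext i
  have := congr_fun h' i
  simp only [Pi.smul_apply, smul_eq_mul] at this
  have hN0 : (N : ℤ) ≠ 0 := by exact_mod_cast (by omega : N ≠ 0)
  exact mul_left_cancel₀ hN0 this

/-- kernel: the terms of the periodization are absolutely summable (`N ≥ 1`). [cite: Balaban1983Higgs3, (2.26) p.431] -/
theorem summable_abs_translate (hC : Summable fun z => (1 + (l1 z : ℝ)) ^ m * |C z|) (hN : 1 ≤ N) (z : ZSite d) :
    Summable fun n : ZSite d => |C (z + (N : ℤ) • n)| := by
  have h0 : Summable fun w : ZSite d => |C w| :=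
    hC.of_nonneg_of_le (fun _ => abs_nonneg _) fun w =>
      le_mul_of_one_le_left (abs_nonneg _) (one_le_weight_pow w m)
  exact h0.comp_injective (injective_translate hN z)

/-- kernel: the terms of the periodization are summable. [cite: Balaban1983Higgs3, (2.26) p.431] -/
theorem summable_translate (hC : Summable fun z => (1 + (l1 z : ℝ)) ^ m * |C z|) (hN : 1 ≤ N) (z : ZSite d) :
    Summable fun n : ZSite d => C (z + (N : ℤ) • n) :=
  (summable_abs_translate hC hN z).of_abs

/-- **`C_N` is `N`-periodic.** [cite: Balaban1983Higgs3, (2.26) p.431] -/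
theorem perC_periodic (N : ℕ) (C : ZSite d → ℝ) (z k : ZSite d) :
    perC N C (z + (N : ℤ) • k) = perC N C z := by
  unfold perC
  rw [← Equiv.tsum_eq (Equiv.addRight k) (fun n => C (z + (N : ℤ) • n))]
  refine tsum_congr fun n => ?_
  simp only [Equiv.coe_addRight, smul_add]
  abel_nf

/-- kernel: `C_N` depends on `z` only through `proj z`. [cite: Balaban1983Higgs3, (2.26) p.431] -/
theorem perC_eq_of_proj_eq {a b : ZSite d} (h : proj N a = proj N b) : perC N C a = perC N C b := by
  obtain ⟨n, rfl⟩ := (proj_eq_iff a b).mp h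
  exact perC_periodic N C b n

/-- **`C_N` is even if `C` is.** [cite: Balaban1983Higgs3, (2.26) p.431] -/
theorem perC_neg (hCeven : ∀ z, C (-z) = C z) (N : ℕ) (z : ZSite d) : perC N C (-z) = perC N C z := by
  unfold perC
  rw [← Equiv.tsum_eq (Equiv.neg (ZSite d)) (fun n => C (-z + (N : ℤ) • n))]
  refine tsum_congr fun n => ?_
  rw [Equiv.neg_apply, smul_neg, ← neg_add, hCeven]

/-- kernel: `−Δ^η` passes under the periodization sum (finite combination of translates). [cite: Balaban1983Higgs3, (2.23) p.430] -/
theorem negLapZ_perC (hC : Summable fun z => (1 + (l1 z : ℝ)) ^ m * |C z|) (hN : 1 ≤ N) (η : ℝ) (z : ZSite d) :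
    negLapZ η (perC N C) z = ∑' n : ZSite d, negLapZ η C (z + (N : ℤ) • n) := by
  have hs := fun w => summable_translate hC hN w
  have h1s : ∀ μ : Fin d, Summable fun n : ZSite d => C (z + (N : ℤ) • n + unitVec μ) := fun μ =>
    (hs (z + unitVec μ)).congr fun n => by rw [show z + unitVec μ + (N : ℤ) • n = z + (N : ℤ) • n + unitVec μ by abel]
  have h2s : ∀ μ : Fin d, Summable fun n : ZSite d => C (z + (N : ℤ) • n - unitVec μ) := fun μ =>
    (hs (z - unitVec μ)).congr fun n => by rw [show z - unitVec μ + (N : ℤ) • n = z + (N : ℤ) • n - unitVec μ by abel]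
  have h2C : Summable fun n : ZSite d => 2 * C (z + (N : ℤ) • n) := (hs z).mul_left 2
  have hterm : ∀ μ ∈ (Finset.univ : Finset (Fin d)), Summable fun n : ZSite d =>
      η⁻¹ ^ 2 * (2 * C (z + (N : ℤ) • n) - C (z + (N : ℤ) • n + unitVec μ) - C (z + (N : ℤ) • n - unitVec μ)) :=
    fun μ _ => ((h2C.sub (h1s μ)).sub (h2s μ)).mul_left _
  unfold negLapZ perC
  rw [Summable.tsum_finsetSum hterm]
  refine Finset.sum_congr rfl fun μ _ => ?_
  have h1 : ∑' n : ZSite d, C (z + unitVec μ + (N : ℤ) • n) = ∑' n : ZSite d, C (z + (N : ℤ) • n + unitVec μ) :=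
    tsum_congr fun n => by rw [show z + unitVec μ + (N : ℤ) • n = z + (N : ℤ) • n + unitVec μ by abel]
  have h2 : ∑' n : ZSite d, C (z - unitVec μ + (N : ℤ) • n) = ∑' n : ZSite d, C (z + (N : ℤ) • n - unitVec μ) :=
    tsum_congr fun n => by rw [show z - unitVec μ + (N : ℤ) • n = z + (N : ℤ) • n - unitVec μ by abel]
  rw [h1, h2]
  conv_rhs => rw [tsum_mul_left, Summable.tsum_sub (h2C.sub (h1s μ)) (h2s μ), Summable.tsum_sub h2C (h1s μ),
    tsum_mul_left]

/-- kernel: the torus `δ`-function pulled back to `ℤ^d` — at most one translate `z + Nn` vanishes: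
`Σ'_n η^{−d}1[z + Nn = 0] = η^{−d}1[proj z = 0]` (as a `HasSum`). [cite: Balaban1983Higgs3, (2.23) p.430] -/
theorem hasSum_delta_translate (hN : 1 ≤ N) (a : ℝ) (z : ZSite d) :
    HasSum (fun n : ZSite d => if z + (N : ℤ) • n = 0 then a else 0) (if proj N z = 0 then a else 0) := by
  by_cases h : ∃ n : ZSite d, z + (N : ℤ) • n = 0
  · obtain ⟨n₀, hn₀⟩ := h
    have hp : proj N z = 0 := (proj_eq_zero_iff z).mpr ⟨n₀, hn₀⟩
    rw [if_pos hp]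
    have hfun : (fun n : ZSite d => if z + (N : ℤ) • n = 0 then a else 0) = fun n => if n = n₀ then a else 0 := by
      funext n
      by_cases hn : n = n₀
      · rw [if_pos hn, if_pos (by rw [hn]; exact hn₀)]
      · rw [if_neg hn, if_neg]
        intro h0
        exact hn (injective_translate hN z (h0.trans hn₀.symm))
    rw [hfun]
    exact hasSum_ite_eq n₀ a
  · have hp : proj N z ≠ 0 := fun h0 => h ((proj_eq_zero_iff z).mp h0)
    rw [if_neg hp]
    have hfun : (fun n : ZSite d => if z + (N : ℤ) • n = 0 then a else 0) = fun _ => 0 := by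
      funext n
      rw [if_neg]
      exact fun h0 => h ⟨n, h0⟩
    rw [hfun]
    exact hasSum_zero

/-- **THE LATTICE EQUATION OF THE PERIODIZATION**: if `(−Δ^η + M²)C = δ^η` on `ℤ^d` then
`(−Δ^η + M²)C_N(z) = η^{−d}·1[z ∈ Nℤ^d]` — the torus `δ`-function pulled back to `ℤ^d`. [cite: Balaban1983Higgs3, (2.23) p.430] -/
theorem negLapZ_perC_add {η M2 : ℝ} (hC : Summable fun z => (1 + (l1 z : ℝ)) ^ m * |C z|) (hN : 1 ≤ N)
    (hCeq : ∀ z, negLapZ η C z + M2 * C z = if z = 0 then η⁻¹ ^ d else 0) (z : ZSite d) :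
    negLapZ η (perC N C) z + M2 * perC N C z = if proj N z = 0 then η⁻¹ ^ d else 0 := by
  have hs := summable_translate hC hN z
  have hδ := hasSum_delta_translate (d := d) hN (η⁻¹ ^ d) z
  have hsL : Summable fun n : ZSite d => negLapZ η C (z + (N : ℤ) • n) := by
    refine (hδ.summable.sub (hs.mul_left M2)).congr fun n => ?_
    rw [← hCeq]; ring
  rw [negLapZ_perC hC hN, perC, ← tsum_mul_left, ← hsL.tsum_add (hs.mul_left M2), ← hδ.tsum_eq]
  exact tsum_congr fun n => hCeq _

end Periodization

/-! ## §3 The torus kernel `CT = C_N ∘ lift` solves the torus lattice equation -/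

section TorusKernel

variable [NeZero N] {m : ℕ} {C : ZSite d → ℝ}

/-- **the torus propagator of period `N`**: the periodization `C_N` read on `(ℤ/Nℤ)^d` (`CT N C t = C_N(lift t)`).
[cite: Balaban1983Higgs3, (2.26) p.431] -/
def CT (N : ℕ) [NeZero N] (C : ZSite d → ℝ) (t : TSite d N) : ℝ := perC N C (lift t)

/-- kernel: `CT(proj a) = C_N(a)` — any representative computes the torus kernel. [cite: Balaban1983Higgs3, (2.26) p.431] -/
theorem CT_eq_perC_of_proj {a : ZSite d} {t : TSite d N} (h : proj N a = t) : CT N C t = perC N C a :=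
  perC_eq_of_proj_eq (by rw [proj_lift, h])

/-- kernel: `CT ∘ proj = C_N`. [cite: Balaban1983Higgs3, (2.26) p.431] -/
theorem CT_proj (z : ZSite d) : CT N C (proj N z) = perC N C z := CT_eq_perC_of_proj rfl

/-- **`CT` is even** (for even `C`). [cite: Balaban1983Higgs3, (2.26) p.431] -/
theorem CT_neg (hCeven : ∀ z, C (-z) = C z) (t : TSite d N) : CT N C (-t) = CT N C t := by
  have h : proj N (-(lift t)) = -t := by rw [proj_neg, proj_lift]
  rw [CT_eq_perC_of_proj h, perC_neg hCeven]
  rfl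

/-- **THE TORUS LATTICE EQUATION OF `CT`**: `(−Δ^η_T + M²)CT = δ^η_T` on `(ℤ/Nℤ)^d` — the periodized infinite-volume propagator IS
a torus propagator (hypothesis shape of `B3WT226PeriodicKernel.bracketT_eq_zero`). [cite: Balaban1983Higgs3, (2.23) p.430] -/
theorem negLapT_CT_add {η M2 : ℝ} (hC : Summable fun z => (1 + (l1 z : ℝ)) ^ m * |C z|) (hN : 1 ≤ N)
    (hCeq : ∀ z, negLapZ η C z + M2 * C z = if z = 0 then η⁻¹ ^ d else 0) (t : TSite d N) :
    negLapT η (CT N C) t + M2 * CT N C t = if t = 0 then η⁻¹ ^ d else 0 := by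
  have hp : ∀ μ : Fin d, CT N C (t + unitVecT μ) = perC N C (lift t + unitVec μ) := fun μ =>
    CT_eq_perC_of_proj (by rw [proj_add, proj_lift, proj_unitVec])
  have hm : ∀ μ : Fin d, CT N C (t - unitVecT μ) = perC N C (lift t - unitVec μ) := fun μ =>
    CT_eq_perC_of_proj (by rw [proj_sub, proj_lift, proj_unitVec])
  have h0 : CT N C t = perC N C (lift t) := rfl
  have key : negLapT η (CT N C) t = negLapZ η (perC N C) (lift t) := by
    simp only [negLapT, negLapZ, hp, hm, h0]
  rw [key, h0, negLapZ_perC_add hC hN hCeq, proj_lift]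

/-- **the torus identity (2.26) for the periodized propagator**: `bracketT η (CT N C) λ_T x μ = 0` for every `N ≥ 2`, every test
function on the torus and every bond (file 1/2 applied). [cite: Balaban1983Higgs3, (2.26) p.431] -/
theorem bracketT_CT_eq_zero [Fact (1 < N)] {η M2 : ℝ} (hη : 0 < η) (hCeven : ∀ z, C (-z) = C z)
    (hCeq : ∀ z, negLapZ η C z + M2 * C z = if z = 0 then η⁻¹ ^ d else 0)
    (hC : Summable fun z => (1 + (l1 z : ℝ)) ^ m * |C z|) (lamT : TSite d N → ℝ) (x : TSite d N) (μ : Fin d) :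
    bracketT η (CT N C) lamT x μ = 0 :=
  bracketT_eq_zero hη (CT_neg hCeven) (negLapT_CT_add hC (Fact.out : 1 < N).le hCeq) x μ

end TorusKernel

/-! ## §4 Finitely supported test functions and their periodizations -/

section TestFunction

variable {S : Finset (ZSite d)} {lam : ZSite d → ℝ}

/-- **the periodized test function** `λ_T(t) = Σ_{s ∈ S, proj s = t} λ(s)` of a test function `λ` supported in the finite set `S`.
[cite: Balaban1983Higgs3, (2.26) p.431] -/
def lamT (N : ℕ) (S : Finset (ZSite d)) (lam : ZSite d → ℝ) (t : TSite d N) : ℝ :=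
  ∑ s ∈ S, if proj N s = t then lam s else 0

/-- kernel: `λ_T(proj z) = λ(z)` at every site `z` of a finite set `T ⊇ S` on which `proj` is injective.
[cite: Balaban1983Higgs3, (2.26) p.431] -/
theorem lamT_proj (hS : ∀ z ∉ S, lam z = 0) {T : Finset (ZSite d)} (hST : S ⊆ T) (hinj : Set.InjOn (proj N) (T : Set (ZSite d)))
    {z : ZSite d} (hz : z ∈ T) : lamT N S lam (proj N z) = lam z := by
  unfold lamT
  by_cases hzS : z ∈ S
  · rw [Finset.sum_eq_single z]
    · rw [if_pos rfl]
    · intro s hs hsz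
      rw [if_neg]
      exact fun h => hsz (hinj (hST hs) hz h)
    · intro h; exact absurd hzS h
  · rw [hS z hzS]
    refine Finset.sum_eq_zero fun s hs => ?_
    rw [if_neg]
    intro h
    exact hzS ((hinj (hST hs) hz h) ▸ hs)

/-- kernel: `λ_T(t) = 0` off the image of the support. [cite: Balaban1983Higgs3, (2.26) p.431] -/
theorem lamT_eq_zero {t : TSite d N} (h : ∀ s ∈ S, proj N s ≠ t) : lamT N S lam t = 0 :=
  Finset.sum_eq_zero fun s hs => if_neg (h s hs)

/-- the sites at which some forward difference `∂_νλ` may be nonzero: `S ∪ {s − e_ν}`. [cite: Balaban1983Higgs3, (2.26) p.431] -/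
def dSupp (S : Finset (ZSite d)) : Finset (ZSite d) :=
  S ∪ S.biUnion fun s => Finset.univ.image fun ν : Fin d => s - unitVec ν

/-- kernel: `S ⊆ dSupp S`. [cite: Balaban1983Higgs3, (2.26) p.431] -/
theorem subset_dSupp (S : Finset (ZSite d)) : S ⊆ dSupp S := Finset.subset_union_left

/-- kernel: `s − e_ν ∈ dSupp S` for `s ∈ S`. [cite: Balaban1983Higgs3, (2.26) p.431] -/
theorem sub_unitVec_mem_dSupp {s : ZSite d} (hs : s ∈ S) (ν : Fin d) : s - unitVec ν ∈ dSupp S :=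
  Finset.mem_union_right _ (Finset.mem_biUnion.2 ⟨s, hs, Finset.mem_image.2 ⟨ν, Finset.mem_univ _, rfl⟩⟩)

/-- kernel: off `dSupp S` every forward difference of `λ` vanishes. [cite: Balaban1983Higgs3, (2.26) p.431] -/
theorem pdiffZ_eq_zero_of_not_mem (hS : ∀ z ∉ S, lam z = 0) {x' : ZSite d} (hx' : x' ∉ dSupp S) (c : ℝ) (ν : Fin d) :
    pdiffZ c ν lam x' = 0 := by
  have h1 : x' ∉ S := fun h => hx' (subset_dSupp S h)
  have h2 : x' + unitVec ν ∉ S := by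
    intro h
    have := sub_unitVec_mem_dSupp h ν
    rw [add_sub_cancel_right] at this
    exact hx' this
  simp only [pdiffZ, hS _ h1, hS _ h2, sub_zero, mul_zero]

end TestFunction

/-! ## §5 The torus bracket is, for large `N`, the free finite-support bracket with kernel `C_N` -/

section Identification

/-- first term of (2.26) on `ℤ^d` with the `b′`-sum restricted to a finite set (for finitely supported test functions the
`tsum` of `B3WT226FreeLattice.wt1` IS this finite sum, `wt1_eq_wt1Fin`). [cite: Balaban1983Higgs3, (2.26) p.431] -/
def wt1Fin (S' : Finset (ZSite d)) (η : ℝ) (K lam : ZSite d → ℝ) (x : ZSite d) (μ : Fin d) : ℝ :=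
  ∑ x' ∈ S', η ^ d * ∑ ν : Fin d, kerCDZ η⁻¹ K x x' ν * kerCDZ η⁻¹ K x' x μ * pdiffZ η⁻¹ ν lam x'

/-- second term of (2.26) on `ℤ^d` with the `b′`-sum restricted to a finite set. [cite: Balaban1983Higgs3, (2.26) p.431] -/
def wt2Fin (S' : Finset (ZSite d)) (η : ℝ) (K lam : ZSite d → ℝ) (x : ZSite d) (μ : Fin d) : ℝ :=
  ∑ x' ∈ S', η ^ d * ∑ ν : Fin d, K (x - x') * kerDCDZ η⁻¹ K x' ν x μ * pdiffZ η⁻¹ ν lam x'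

/-- the per-bond right member of (2.26) on `ℤ^d` with finite `b′`-sums. [cite: Balaban1983Higgs3, (2.26) p.431] -/
def bracketFin (S' : Finset (ZSite d)) (η : ℝ) (K lam : ZSite d → ℝ) (x : ZSite d) (μ : Fin d) : ℝ :=
  -wt1Fin S' η K lam x μ + wt2Fin S' η K lam x μ - wt3 η K lam x μ - wt4 η K lam x μ

variable {S : Finset (ZSite d)} {lam : ZSite d → ℝ} {η : ℝ}

/-- kernel: for a test function supported in `S`, the free `wt1` is the finite sum over `dSupp S` — whatever the kernel.
[cite: Balaban1983Higgs3, (2.26) p.431] -/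
theorem wt1_eq_wt1Fin (hS : ∀ z ∉ S, lam z = 0) (K : ZSite d → ℝ) (x : ZSite d) (μ : Fin d) :
    wt1 η K lam x μ = wt1Fin (dSupp S) η K lam x μ := by
  unfold wt1 wt1Fin
  refine tsum_eq_sum fun x' hx' => ?_
  simp only [pdiffZ_eq_zero_of_not_mem hS hx', mul_zero, Finset.sum_const_zero]

/-- kernel: likewise for `wt2`. [cite: Balaban1983Higgs3, (2.26) p.431] -/
theorem wt2_eq_wt2Fin (hS : ∀ z ∉ S, lam z = 0) (K : ZSite d → ℝ) (x : ZSite d) (μ : Fin d) :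
    wt2 η K lam x μ = wt2Fin (dSupp S) η K lam x μ := by
  unfold wt2 wt2Fin
  refine tsum_eq_sum fun x' hx' => ?_
  simp only [pdiffZ_eq_zero_of_not_mem hS hx', mul_zero, Finset.sum_const_zero]

/-- **the free bracket of `B3WT226FreeLattice` is the finite-support bracket** for a finitely supported test function.
[cite: Balaban1983Higgs3, (2.26) p.431] -/
theorem bracket226_eq_bracketFin (hS : ∀ z ∉ S, lam z = 0) (K : ZSite d → ℝ) (x : ZSite d) (μ : Fin d) :
    bracket226 η K lam x μ = bracketFin (dSupp S) η K lam x μ := by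
  rw [bracket226, bracketFin, wt1_eq_wt1Fin hS, wt2_eq_wt2Fin hS]

/-- the finite set of sites at which `λ_T ∘ proj = λ` is needed: the support data and the bond. [cite: Balaban1983Higgs3, (2.26) p.431] -/
def bigT (S : Finset (ZSite d)) (x : ZSite d) : Finset (ZSite d) :=
  dSupp S ∪ (dSupp S).biUnion (fun x' => Finset.univ.image fun ν : Fin d => x' + unitVec ν) ∪
    ({x} ∪ Finset.univ.image fun ν : Fin d => x + unitVec ν)

/-- kernel: membership facts of `bigT`. [cite: Balaban1983Higgs3, (2.26) p.431] -/
theorem mem_bigT (S : Finset (ZSite d)) (x : ZSite d) :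
    dSupp S ⊆ bigT S x ∧ (∀ x' ∈ dSupp S, ∀ ν : Fin d, x' + unitVec ν ∈ bigT S x) ∧ x ∈ bigT S x ∧
      ∀ ν : Fin d, x + unitVec ν ∈ bigT S x := by
  refine ⟨fun z hz => ?_, fun x' hx' ν => ?_, ?_, fun ν => ?_⟩
  · exact Finset.mem_union_left _ (Finset.mem_union_left _ hz)
  · exact Finset.mem_union_left _ (Finset.mem_union_right _
      (Finset.mem_biUnion.2 ⟨x', hx', Finset.mem_image.2 ⟨ν, Finset.mem_univ _, rfl⟩⟩))
  · exact Finset.mem_union_right _ (Finset.mem_union_left _ (Finset.mem_singleton_self x))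
  · exact Finset.mem_union_right _ (Finset.mem_union_right _ (Finset.mem_image.2 ⟨ν, Finset.mem_univ _, rfl⟩))

/-- kernel: the torus difference quotient of `λ_T` at `proj x′` is the free one of `λ` at `x′` (both points in `bigT`).
[cite: Balaban1983Higgs3, (2.26) p.431] -/
theorem pdiffT_lamT_proj (hS : ∀ z ∉ S, lam z = 0) {T : Finset (ZSite d)} (hST : S ⊆ T)
    (hinj : Set.InjOn (proj N) (T : Set (ZSite d))) {x' : ZSite d} (hx' : x' ∈ T) (c : ℝ) (ν : Fin d)
    (hx'ν : x' + unitVec ν ∈ T) :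
    pdiffT c ν (lamT N S lam) (proj N x') = pdiffZ c ν lam x' := by
  simp only [pdiffT, pdiffZ]
  rw [← proj_unitVec, ← proj_add, lamT_proj hS hST hinj hx'ν, lamT_proj hS hST hinj hx']

/-- kernel: a torus `b′`-sum of terms carrying a factor `(∂_νλ_T)(t)` reduces to the sites `t ∈ proj(dSupp S)`.
[cite: Balaban1983Higgs3, (2.26) p.431] -/
theorem pdiffT_lamT_eq_zero {t : TSite d N} (ht : t ∉ (dSupp S).image (proj N)) (c : ℝ) (ν : Fin d) :
    pdiffT c ν (lamT N S lam) t = 0 := by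
  have h1 : lamT N S lam t = 0 := lamT_eq_zero fun s hs hst =>
    ht (Finset.mem_image.2 ⟨s, subset_dSupp S hs, hst⟩)
  have h2 : lamT N S lam (t + unitVecT ν) = 0 := lamT_eq_zero fun s hs hst => by
    refine ht (Finset.mem_image.2 ⟨s - unitVec ν, sub_unitVec_mem_dSupp hs ν, ?_⟩)
    rw [proj_sub, proj_unitVec, hst, add_sub_cancel_right]
  simp only [pdiffT, h1, h2, sub_zero, mul_zero]

variable [NeZero N] {C : ZSite d → ℝ}

/-- kernel: the torus kernel `(CT∂^{η*})` at reduced points is the free kernel of `C_N`. [cite: Balaban1983Higgs3, (2.26) p.431] -/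
theorem kerCDT_CT_proj (c : ℝ) (y x : ZSite d) (μ : Fin d) :
    kerCDT c (CT N C) (proj N y) (proj N x) μ = kerCDZ c (perC N C) y x μ := by
  simp only [kerCDT, kerCDZ]
  rw [CT_eq_perC_of_proj (a := y - (x + unitVec μ)) (by rw [proj_sub, proj_add, proj_unitVec]),
    CT_eq_perC_of_proj (a := y - x) (by rw [proj_sub])]

/-- kernel: the torus kernel `(∂CT∂^{η*})` at reduced points is the free kernel of `C_N`. [cite: Balaban1983Higgs3, (2.26) p.431] -/
theorem kerDCDT_CT_proj (c : ℝ) (x' : ZSite d) (ν : Fin d) (x : ZSite d) (μ : Fin d) :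
    kerDCDT c (CT N C) (proj N x') ν (proj N x) μ = kerDCDZ c (perC N C) x' ν x μ := by
  simp only [kerDCDT, kerDCDZ]
  rw [CT_eq_perC_of_proj (a := x' + unitVec ν - (x + unitVec μ))
      (by rw [proj_sub, proj_add, proj_add, proj_unitVec, proj_unitVec]),
    CT_eq_perC_of_proj (a := x' + unitVec ν - x) (by rw [proj_sub, proj_add, proj_unitVec]),
    CT_eq_perC_of_proj (a := x' - (x + unitVec μ)) (by rw [proj_sub, proj_add, proj_unitVec]),
    CT_eq_perC_of_proj (a := x' - x) (by rw [proj_sub])]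

/-- **THE TORUS BRACKET IS THE FREE FINITE-SUPPORT BRACKET WITH KERNEL `C_N`** once `proj` is injective on the support data
`bigT S x` (true for `N` larger than its diameter): `bracketT η (CT N C) λ_T (proj x) μ = bracketFin (dSupp S) η C_N λ x μ`.
[cite: Balaban1983Higgs3, (2.26) p.431] -/
theorem bracketT_CT_eq_bracketFin (hS : ∀ z ∉ S, lam z = 0) (x : ZSite d) (μ : Fin d)
    (hinj : Set.InjOn (proj N) (bigT S x : Set (ZSite d))) :
    bracketT η (CT N C) (lamT N S lam) (proj N x) μ = bracketFin (dSupp S) η (perC N C) lam x μ := by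
  obtain ⟨hD, hDe, hx, hxe⟩ := mem_bigT S x
  have hST : S ⊆ bigT S x := (subset_dSupp S).trans hD
  have hinjD : Set.InjOn (proj N) (dSupp S : Set (ZSite d)) := hinj.mono (by exact_mod_cast hD)
  -- the difference quotients of λ_T along proj
  have hd : ∀ x' ∈ dSupp S, ∀ ν : Fin d, pdiffT η⁻¹ ν (lamT N S lam) (proj N x') = pdiffZ η⁻¹ ν lam x' :=
    fun x' hx' ν => pdiffT_lamT_proj hS hST hinj (hD hx') η⁻¹ ν (hDe x' hx' ν)
  have hdx : pdiffT η⁻¹ μ (lamT N S lam) (proj N x) = pdiffZ η⁻¹ μ lam x :=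
    pdiffT_lamT_proj hS hST hinj hx η⁻¹ μ (hxe μ)
  -- the two b′-sums
  have h1 : wtT1 η (CT N C) (lamT N S lam) (proj N x) μ = wt1Fin (dSupp S) η (perC N C) lam x μ := by
    unfold wtT1 wt1Fin
    rw [← Finset.sum_subset (Finset.subset_univ ((dSupp S).image (proj N))) (fun t _ ht => by
      simp only [pdiffT_lamT_eq_zero ht, mul_zero, Finset.sum_const_zero]),
      Finset.sum_image (fun a ha b hb h => hinjD ha hb h)]
    refine Finset.sum_congr rfl fun x' hx' => ?_
    congr 1
    refine Finset.sum_congr rfl fun ν _ => ?_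
    rw [kerCDT_CT_proj, kerCDT_CT_proj, hd x' hx' ν]
  have h2 : wtT2 η (CT N C) (lamT N S lam) (proj N x) μ = wt2Fin (dSupp S) η (perC N C) lam x μ := by
    unfold wtT2 wt2Fin
    rw [← Finset.sum_subset (Finset.subset_univ ((dSupp S).image (proj N))) (fun t _ ht => by
      simp only [pdiffT_lamT_eq_zero ht, mul_zero, Finset.sum_const_zero]),
      Finset.sum_image (fun a ha b hb h => hinjD ha hb h)]
    refine Finset.sum_congr rfl fun x' hx' => ?_
    congr 1
    refine Finset.sum_congr rfl fun ν _ => ?_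
    rw [← proj_sub, CT_proj, kerDCDT_CT_proj, hd x' hx' ν]
  have h3 : wtT3 η (CT N C) (lamT N S lam) (proj N x) μ = wt3 η (perC N C) lam x μ := by
    unfold wtT3 wt3
    rw [hdx, CT_eq_perC_of_proj (a := (0 : ZSite d)) proj_zero]
  have h4 : wtT4 η (CT N C) (lamT N S lam) (proj N x) μ = wt4 η (perC N C) lam x μ := by
    unfold wtT4 wt4
    rw [hdx, kerCDT_CT_proj]
  rw [bracketT, bracketFin, h1, h2, h3, h4]

end Identification

/-! ## §6 The limit `N → ∞`: `C_N → C` pointwise, the finite-support bracket converges, the free identity follows -/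

section Limit

variable {m : ℕ} {C : ZSite d → ℝ}

/-- kernel: `|Nn|₁ = N|n|₁`. [cite: Balaban1983Higgs3, (2.26) p.431] -/
theorem l1_nsmul (N : ℕ) (n : ZSite d) : l1 ((N : ℤ) • n) = N * l1 n := by
  unfold l1
  rw [Finset.mul_sum]
  refine Finset.sum_congr rfl fun i _ => ?_
  simp [Int.natAbs_mul]

/-- kernel: `n ≠ 0 → 1 ≤ |n|₁`. [cite: Balaban1983Higgs3, (2.26) p.431] -/
theorem one_le_l1_of_ne_zero {n : ZSite d} (hn : n ≠ 0) : 1 ≤ l1 n := by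
  obtain ⟨i, hi⟩ : ∃ i, n i ≠ 0 := by
    by_contra h
    push Not at h
    exact hn (funext h)
  unfold l1
  calc 1 ≤ (n i).natAbs := Nat.one_le_iff_ne_zero.mpr (Int.natAbs_ne_zero.mpr hi)
    _ ≤ ∑ j, (n j).natAbs := Finset.single_le_sum (f := fun j => (n j).natAbs) (fun _ _ => Nat.zero_le _) (Finset.mem_univ i)

/-- kernel: the nonzero translates are far away, `N − |z|₁ ≤ |z + Nn|₁` (`n ≠ 0`). [cite: Balaban1983Higgs3, (2.26) p.431] -/
theorem sub_le_l1_translate (N : ℕ) (z : ZSite d) {n : ZSite d} (hn : n ≠ 0) :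
    (N : ℝ) - l1 z ≤ l1 (z + (N : ℤ) • n) := by
  have h1 : l1 ((N : ℤ) • n) ≤ l1 (z + (N : ℤ) • n) + l1 z := by
    have := l1_add_le (z + (N : ℤ) • n) (-z)
    rwa [← sub_eq_add_neg, add_sub_cancel_left, l1_neg] at this
  have h2 : l1 ((N : ℤ) • n) = N * l1 n := l1_nsmul N n
  have h3 : 1 ≤ l1 n := one_le_l1_of_ne_zero hn
  have h4 : N ≤ l1 (z + (N : ℤ) • n) + l1 z :=
    calc N = N * 1 := (mul_one N).symm
      _ ≤ N * l1 n := Nat.mul_le_mul_left N h3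
      _ ≤ _ := h2 ▸ h1
  have : (N : ℝ) ≤ (l1 (z + (N : ℤ) • n) : ℝ) + (l1 z : ℝ) := by exact_mod_cast h4
  linarith

/-- **THE PERIODIZATION ERROR**: `|C_N(z) − C(z)| ≤ (Σ_w (1+|w|₁)^m|C(w)|)/(1 + N − |z|₁)` for `N ≥ max(1, |z|₁)`, `m ≥ 1` — the
nonzero translates all lie at `ℓ¹`-distance `≥ N − |z|₁`, where the weight `(1+|w|₁)^m ≥ 1 + N − |z|₁`. [cite: Balaban1983Higgs3, (2.26) p.431] -/
theorem abs_perC_sub_le (hC : Summable fun z => (1 + (l1 z : ℝ)) ^ m * |C z|) (hm : 1 ≤ m) {N : ℕ} {z : ZSite d}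
    (hN : l1 z ≤ N) (hN1 : 1 ≤ N) :
    |perC N C z - C z| ≤ (∑' w, (1 + (l1 w : ℝ)) ^ m * |C w|) / (1 + N - l1 z) := by
  set D : ℝ := 1 + N - l1 z with hD
  have hzN : (l1 z : ℝ) ≤ N := by exact_mod_cast hN
  have hDpos : 0 < D := by rw [hD]; linarith
  have hsum := summable_translate hC hN1 z
  have htr := hC.comp_injective (injective_translate hN1 z)
  -- split off the term n = 0
  have hsplit : perC N C z - C z = ∑' n : ZSite d, if n = 0 then 0 else C (z + (N : ℤ) • n) := by
    unfold perC
    rw [hsum.tsum_eq_add_tsum_ite 0]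
    simp only [smul_zero, add_zero, add_sub_cancel_left]
  -- termwise bound by the weighted terms
  have hg_le : ∀ n : ZSite d, |(if n = 0 then 0 else C (z + (N : ℤ) • n))| ≤
      D⁻¹ * ((fun w => (1 + (l1 w : ℝ)) ^ m * |C w|) ∘ fun n : ZSite d => z + (N : ℤ) • n) n := by
    intro n
    simp only [Function.comp]
    by_cases hn : n = 0
    · simp only [hn, if_true, abs_zero]
      exact mul_nonneg (inv_nonneg.2 hDpos.le) (mul_nonneg (pow_nonneg (by positivity) _) (abs_nonneg _))
    · simp only [hn, if_false]
      have hw : D ≤ 1 + (l1 (z + (N : ℤ) • n) : ℝ) := by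
        have := sub_le_l1_translate N z hn
        rw [hD]; linarith
      have hw' : D ≤ (1 + (l1 (z + (N : ℤ) • n) : ℝ)) ^ m :=
        calc D ≤ 1 + (l1 (z + (N : ℤ) • n) : ℝ) := hw
          _ = (1 + (l1 (z + (N : ℤ) • n) : ℝ)) ^ 1 := (pow_one _).symm
          _ ≤ (1 + (l1 (z + (N : ℤ) • n) : ℝ)) ^ m := pow_le_pow_right₀ (le_add_of_nonneg_right (by positivity)) hm
      calc |C (z + (N : ℤ) • n)| = D⁻¹ * (D * |C (z + (N : ℤ) • n)|) := by
            rw [← mul_assoc, inv_mul_cancel₀ hDpos.ne', one_mul]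
        _ ≤ D⁻¹ * ((1 + (l1 (z + (N : ℤ) • n) : ℝ)) ^ m * |C (z + (N : ℤ) • n)|) :=
            mul_le_mul_of_nonneg_left (mul_le_mul_of_nonneg_right hw' (abs_nonneg _)) (inv_nonneg.2 hDpos.le)
  have hsg : Summable fun n : ZSite d => |(if n = 0 then 0 else C (z + (N : ℤ) • n))| :=
    (htr.mul_left D⁻¹).of_nonneg_of_le (fun _ => abs_nonneg _) hg_le
  rw [hsplit]
  calc |∑' n : ZSite d, (if n = 0 then 0 else C (z + (N : ℤ) • n))|
        ≤ ∑' n : ZSite d, |(if n = 0 then 0 else C (z + (N : ℤ) • n))| := by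
          have := norm_tsum_le_tsum_norm (f := fun n : ZSite d => (if n = 0 then 0 else C (z + (N : ℤ) • n)))
            (by simpa only [Real.norm_eq_abs] using hsg)
          simpa only [Real.norm_eq_abs] using this
    _ ≤ ∑' n : ZSite d, D⁻¹ * ((fun w => (1 + (l1 w : ℝ)) ^ m * |C w|) ∘ fun n : ZSite d => z + (N : ℤ) • n) n :=
          Summable.tsum_le_tsum hg_le hsg (htr.mul_left D⁻¹)
    _ = D⁻¹ * ∑' n : ZSite d, ((fun w => (1 + (l1 w : ℝ)) ^ m * |C w|) ∘ fun n : ZSite d => z + (N : ℤ) • n) n :=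
          tsum_mul_left
    _ ≤ D⁻¹ * ∑' w, (1 + (l1 w : ℝ)) ^ m * |C w| := by
          refine mul_le_mul_of_nonneg_left ?_ (inv_nonneg.2 hDpos.le)
          exact Summable.tsum_le_tsum_of_inj (fun n : ZSite d => z + (N : ℤ) • n) (injective_translate hN1 z)
            (fun w _ => mul_nonneg (pow_nonneg (by positivity) _) (abs_nonneg _)) (fun _ => le_rfl) htr hC
    _ = (∑' w, (1 + (l1 w : ℝ)) ^ m * |C w|) / D := by rw [div_eq_inv_mul]

/-- **`C_N → C` POINTWISE as the period `N → ∞`** (`m ≥ 1`). [cite: Balaban1983Higgs3, (2.26) p.431] -/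
theorem tendsto_perC (hC : Summable fun z => (1 + (l1 z : ℝ)) ^ m * |C z|) (hm : 1 ≤ m) (z : ZSite d) :
    Tendsto (fun N : ℕ => perC N C z) atTop (𝓝 (C z)) := by
  set Sm : ℝ := ∑' w, (1 + (l1 w : ℝ)) ^ m * |C w|
  have hD : Tendsto (fun N : ℕ => (1 + (N : ℝ) - l1 z)) atTop atTop := by
    have : (fun N : ℕ => (1 + (N : ℝ) - l1 z)) = fun N : ℕ => (1 - (l1 z : ℝ)) + (N : ℝ) := by
      funext N; ring
    rw [this]
    exact tendsto_atTop_add_const_left _ _ tendsto_natCast_atTop_atTop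
  have hb : Tendsto (fun N : ℕ => Sm / (1 + (N : ℝ) - l1 z)) atTop (𝓝 0) := by
    have := (tendsto_inv_atTop_zero.comp hD).const_mul Sm
    rw [mul_zero] at this
    simpa only [div_eq_mul_inv, Function.comp] using this
  have hev : ∀ᶠ N : ℕ in atTop, ‖perC N C z - C z‖ ≤ Sm / (1 + (N : ℝ) - l1 z) := by
    refine eventually_atTop.2 ⟨l1 z + 1, fun N hN => ?_⟩
    rw [Real.norm_eq_abs]
    exact abs_perC_sub_le hC hm (by omega) (by omega)
  exact tendsto_sub_nhds_zero_iff.1 (squeeze_zero_norm' hev hb)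

variable {S : Finset (ZSite d)} {lam : ZSite d → ℝ}

/-- **THE FINITE-SUPPORT BRACKET IS CONTINUOUS IN THE KERNEL along `C_N → C`**: `bracketFin S′ η C_N λ x μ → bracketFin S′ η C λ x μ`
(finitely many kernel values enter). [cite: Balaban1983Higgs3, (2.26) p.431] -/
theorem tendsto_bracketFin (hC : Summable fun z => (1 + (l1 z : ℝ)) ^ m * |C z|) (hm : 1 ≤ m) (S' : Finset (ZSite d)) (η : ℝ)
    (lam : ZSite d → ℝ) (x : ZSite d) (μ : Fin d) :
    Tendsto (fun N : ℕ => bracketFin S' η (perC N C) lam x μ) atTop (𝓝 (bracketFin S' η C lam x μ)) := by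
  have hK : ∀ w, Tendsto (fun N : ℕ => perC N C w) atTop (𝓝 (C w)) := tendsto_perC hC hm
  have hCD : ∀ (c : ℝ) (y x' : ZSite d) (ν : Fin d),
      Tendsto (fun N : ℕ => kerCDZ c (perC N C) y x' ν) atTop (𝓝 (kerCDZ c C y x' ν)) := by
    intro c y x' ν
    simp only [kerCDZ]
    exact ((hK _).sub (hK _)).const_mul c
  have hDCD : ∀ (c : ℝ) (x' : ZSite d) (ν : Fin d) (y : ZSite d) (μ' : Fin d),
      Tendsto (fun N : ℕ => kerDCDZ c (perC N C) x' ν y μ') atTop (𝓝 (kerDCDZ c C x' ν y μ')) := by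
    intro c x' ν y μ'
    simp only [kerDCDZ]
    exact ((((hK _).sub (hK _)).sub (hK _)).add (hK _)).const_mul (c ^ 2)
  have h1 : Tendsto (fun N : ℕ => wt1Fin S' η (perC N C) lam x μ) atTop (𝓝 (wt1Fin S' η C lam x μ)) := by
    simp only [wt1Fin]
    exact tendsto_finsetSum _ fun x' _ => (tendsto_finsetSum _ fun ν _ =>
      ((hCD η⁻¹ x x' ν).mul (hCD η⁻¹ x' x μ)).mul_const _).const_mul _
  have h2 : Tendsto (fun N : ℕ => wt2Fin S' η (perC N C) lam x μ) atTop (𝓝 (wt2Fin S' η C lam x μ)) := by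
    simp only [wt2Fin]
    exact tendsto_finsetSum _ fun x' _ => (tendsto_finsetSum _ fun ν _ =>
      (((hK (x - x')).mul (hDCD η⁻¹ x' ν x μ)).mul_const _)).const_mul _
  have h3 : Tendsto (fun N : ℕ => wt3 η (perC N C) lam x μ) atTop (𝓝 (wt3 η C lam x μ)) := by
    simp only [wt3]
    exact (hK 0).const_mul _
  have h4 : Tendsto (fun N : ℕ => wt4 η (perC N C) lam x μ) atTop (𝓝 (wt4 η C lam x μ)) := by
    simp only [wt4]
    exact (hCD η⁻¹ x x μ).const_mul _
  simp only [bracketFin]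
  exact ((h1.neg.add h2).sub h3).sub h4

/-- **THE TORUS IDENTITIES FORCE THE FINITE-SUPPORT BRACKET OF `C_N` TO VANISH** for every period `N` exceeding the diameter data
`2·sup_{bigT S x}|·|₁` (and `N ≥ 2`). [cite: Balaban1983Higgs3, (2.26) p.431] -/
theorem bracketFin_perC_eq_zero {η M2 : ℝ} (hη : 0 < η) (hCeven : ∀ z, C (-z) = C z)
    (hCeq : ∀ z, negLapZ η C z + M2 * C z = if z = 0 then η⁻¹ ^ d else 0)
    (hC : Summable fun z => (1 + (l1 z : ℝ)) ^ m * |C z|) (hS : ∀ z ∉ S, lam z = 0) (x : ZSite d) (μ : Fin d) {N : ℕ}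
    (hN2 : 2 ≤ N) (hN : 2 * (bigT S x).sup (fun z => l1 z) < N) :
    bracketFin (dSupp S) η (perC N C) lam x μ = 0 := by
  haveI : NeZero N := ⟨by omega⟩
  haveI : Fact (1 < N) := ⟨by omega⟩
  rw [← bracketT_CT_eq_bracketFin hS x μ (injOn_proj_of_lt (bigT S x) hN)]
  exact bracketT_CT_eq_zero hη hCeven hCeq hC (lamT N S lam) (proj N x) μ

/-- **THE PRINTED LIMIT ROUTE, MODEL-FREE — (2.26) AT FREE BOUNDARY CONDITIONS FROM THE PERIODIC IDENTITIES**: for an even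
solution `C` of `(−Δ^η + M²)C = δ^η` on `ηℤ^d` with `Σ(1+|z|₁)^m|C(z)| < ∞` (`m ≥ 1`) and a finitely supported test function `λ`, the
per-bond right member `bracket226 η C λ x μ` of (2.26) vanishes — obtained, as printed («They hold for free boundary conditions also
by taking a limit of the identities with periodic boundary conditions», p. 431), as the `N → ∞` limit of the torus identities of
`B3WT226PeriodicKernel` for the periodizations `C_N`. (File 1's `B3WT226FreeLattice.bracket226_eq_zero` is the direct proof, for all
polynomially bounded `λ`.) [cite: Balaban1983Higgs3, (2.26) p.431] -/
theorem bracket226_eq_zero_of_periodic_limit {η M2 : ℝ} (hη : 0 < η) (hCeven : ∀ z, C (-z) = C z)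
    (hCeq : ∀ z, negLapZ η C z + M2 * C z = if z = 0 then η⁻¹ ^ d else 0)
    (hC : Summable fun z => (1 + (l1 z : ℝ)) ^ m * |C z|) (hm : 1 ≤ m) (S : Finset (ZSite d)) (hS : ∀ z ∉ S, lam z = 0)
    (x : ZSite d) (μ : Fin d) : bracket226 η C lam x μ = 0 := by
  rw [bracket226_eq_bracketFin hS]
  have hlim := tendsto_bracketFin hC hm (dSupp S) η lam x μ
  have hev : ∀ᶠ N : ℕ in atTop, bracketFin (dSupp S) η (perC N C) lam x μ = 0 :=
    eventually_atTop.2 ⟨2 * (bigT S x).sup (fun z => l1 z) + 2, fun N hN =>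
      bracketFin_perC_eq_zero hη hCeven hCeq hC hS x μ (by omega) (by omega)⟩
  exact tendsto_nhds_unique hlim (tendsto_const_nhds.congr' (hev.mono fun N hN => hN.symm))

/-- **(2.26) at free boundary conditions, printed limit route — the identity `0 = e_kη^dA_b·tr q²·bracket`** for finitely supported `λ`.
[cite: Balaban1983Higgs3, (2.26) p.431] -/
theorem eq226_free_of_periodic_limit {η M2 : ℝ} (hη : 0 < η) (hCeven : ∀ z, C (-z) = C z)
    (hCeq : ∀ z, negLapZ η C z + M2 * C z = if z = 0 then η⁻¹ ^ d else 0)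
    (hC : Summable fun z => (1 + (l1 z : ℝ)) ^ m * |C z|) (hm : 1 ≤ m) (S : Finset (ZSite d)) (hS : ∀ z ∉ S, lam z = 0)
    (ek trq2 : ℝ) (A : ZSite d → Fin d → ℝ) (x : ZSite d) (μ : Fin d) :
    ek * η ^ d * A x μ * trq2 * bracket226 η C lam x μ = 0 := by
  rw [bracket226_eq_zero_of_periodic_limit hη hCeven hCeq hC hm S hS, mul_zero]

/-- **INSTANCE: the infinite-volume propagator `C^η_{M²}`** of file 1 (`CetaM d η M²`, `η > 0`, `M² > 0`): (2.26) at free boundary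
conditions for finitely supported `λ` by the printed limit route. [cite: Balaban1983Higgs3, (2.26) p.431] -/
theorem bracket226_CetaM_eq_zero_of_periodic_limit {η M2 : ℝ} (hη : 0 < η) (hM : 0 < M2) (S : Finset (ZSite d))
    (hS : ∀ z ∉ S, lam z = 0) (x : ZSite d) (μ : Fin d) : bracket226 η (CetaM d η M2) lam x μ = 0 :=
  bracket226_eq_zero_of_periodic_limit (m := 1) hη CetaM_neg (negLapZ_CetaM_add hη hM)
    (summable_weight_CetaM hη hM 1) le_rfl S hS x μ

end Limit

end

end Literature.MathematicalPhysics.QuantumFieldTheory.Balaban1983to89.B3WT226PeriodicLimit
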